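import Summits.ValiantsHypothesis.ValiantsHypothesis.Theorems.LacunarySymmetroidMatrixDescartesGraftToolkit

/-!
# `MatrixDescartes` census — THE JUNCTION LAW (chain lemma) for alternation certificates, all formats

HONEST FRAMING.  Object-search cell `pub-symmetroid`, crux `Theses.LacunarySymmetroid.MatrixDescartes`
(stmt-ValiantsHypothesis-18050); seat val-sym-mdr-p1 (g8); the desk's «CHAIN LEMMA» (rulings R1894 (b) / R1909 (3) / R1987 (A)),
in the GENERAL JUNCTION FORM.  LOWER-bound / construction mathematics in census (CONJECTURE-A) currency: it proves NOTHING about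
the crux `MatrixDescartes` (an UPPER-bound statement at fat formats), nothing about `DoorA26` / `DoorA34`, nothing about `VP ≠ VNP`.
No definitions in this file.

THE JUNCTION STEP (`exists_alternating_junction`).  Let `P = ∑ l, X^(d l) • S l` (`K₁+1` letters, strictly increasing support,
top exponent `a = d last`, top letter `J = S last`) carry an alternation certificate `0 < τ 0 < ⋯ < τ N₁` (`det P (τ j) ≠ 0`,
consecutive signs opposite), and let `Q = ∑ l, X^(e l) • T l` (`K₂+1` letters, strictly increasing support, bottom exponent
`b = e 0`) carry a certificate `0 < σ 0 < ⋯ < σ N₂`, with the JUNCTION CONDITION `T 0 = J` (the bottom letter of `Q` is the top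
letter of `P`).  For a scale `Λ → ∞` put
`H_Λ(x) = P(x) + ∑_{l ≥ 1} Λ^{−(e l − b)} X^{a + e l − b} • T l = P(x) + x^a · (y^{−b} Q(y) − J)|_{y = x/Λ}`,
a real symmetric pencil with `K₁ + 1 + K₂` letters on a strictly increasing support.  At the old points `τ j` the appended letters
die (`det H_Λ(τ j) → det P(τ j)`); at the rescaled points `Λ σ j` one has `(Λσ j)^{−a} H_Λ(Λ σ j) = J + R(σ j) + o(1) =
σ j^{−b} Q(σ j) + o(1)` because every non-top letter of `P` dies after the division (`d i < a`).  Finitely many eventual sign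
statements give one `Λ`; the junction point `Λ σ 0` is dropped when `det P(τ N₁)` and `det Q(σ 0)` have the same sign (else the
last point is dropped), so the chained pencil alternates along `N₁ + N₂ + 1` positive points: **`N₁ + N₂` alternations with
`K₁ + K₂ + 1` letters** — in census words `ζ_sym(m, K₁ + K₂ + 1) ≥ ζ_alt(P) + ζ_alt(Q)` whenever the junction letters agree
(congruent junction letters suffice: certificates are congruence invariant, companion file `…ChainLaw.lean`).  The statement
records the bookkeeping a chain needs: the first block is kept verbatim (`d' (castAdd i) = d i`, `S' (castAdd i) = S i`), the
appended block is `(a + e l.succ − b, Λ^{−(e l.succ − b)} • T l.succ)`, the new support is strictly increasing.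
The SELF-CHAIN (a certificate chained with its own `x ↦ 1/x` reversal, whose bottom letter IS the source's top letter) and the
headline `ζ_sym(m,7) ≥ 2m² + 4m` for every `m` are in the companion file.  Everything is def-free, in the evaluated-determinant
shape of the tree's certificate lemmas (`Census.le_card_roots_pencil_of_alternating`, `Graft.not_posRootLawAt_of_alternating`).
[folklore] throughout (continuity of `det`, `Λ^{−k} → 0`, intermediate value theorem downstream).
-/

-- `Summit.ValiantsHypothesis.ValiantsHypothesis.…` repeats a component by the D-0017 layout
-- (single-conjunct summit), which the `dupNamespace` linter flags; the name is mandated.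
set_option linter.dupNamespace false

namespace Summit.ValiantsHypothesis.ValiantsHypothesis.Theorems.LacunarySymmetroidMatrixDescartes.Census.Chain

open Matrix Finset Filter Topology
open scoped BigOperators
open Summit.ValiantsHypothesis.ValiantsHypothesis.Theorems.LacunarySymmetroidMatrixDescartes.Census.Graft

/-! ### Bookkeeping for appended letter blocks -/

/-- Appending a strictly increasing block above a strictly increasing block whose values exceed the last value of the first
block gives a strictly increasing sequence. [folklore] -/
theorem strictMono_append {n k : ℕ} {u : Fin (n + 1) → ℕ} {v : Fin k → ℕ} (hu : StrictMono u) (hv : StrictMono v)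
    (huv : ∀ j, u (Fin.last n) < v j) : StrictMono (Fin.append u v) := by
  intro i j hij
  induction i using Fin.addCases with
  | left i =>
    induction j using Fin.addCases with
    | left j =>
      rw [Fin.append_left, Fin.append_left]
      refine hu (Fin.lt_def.mpr ?_)
      have h := Fin.lt_def.mp hij
      simpa using h
    | right j =>
      rw [Fin.append_left, Fin.append_right]
      exact (hu.monotone (Fin.le_last i)).trans_lt (huv j)
  | right i =>
    induction j using Fin.addCases with
    | left j =>
      exfalso
      have h := Fin.lt_def.mp hij
      simp only [Fin.val_natAdd, Fin.val_castAdd] at h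
      omega
    | right j =>
      rw [Fin.append_right, Fin.append_right]
      refine hv (Fin.lt_def.mpr ?_)
      have h := Fin.lt_def.mp hij
      simpa using h

/-- Value of an appended pencil: first block plus second block. [folklore] -/
theorem append_eval {m K₁ K₂ : ℕ} (d₁ : Fin K₁ → ℕ) (S₁ : Fin K₁ → Matrix (Fin m) (Fin m) ℝ)
    (d₂ : Fin K₂ → ℕ) (S₂ : Fin K₂ → Matrix (Fin m) (Fin m) ℝ) (y : ℝ) :
    ∑ l, y ^ (Fin.append d₁ d₂ : Fin (K₁ + K₂) → ℕ) l •
        (Fin.append S₁ S₂ : Fin (K₁ + K₂) → Matrix (Fin m) (Fin m) ℝ) l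
      = (∑ l, y ^ d₁ l • S₁ l) + ∑ l, y ^ d₂ l • S₂ l := by
  rw [Fin.sum_univ_add]
  simp only [Fin.append_left, Fin.append_right]

/-- Appending symmetric blocks gives symmetric letters. [folklore] -/
theorem isSymm_append {m K₁ K₂ : ℕ} {S₁ : Fin K₁ → Matrix (Fin m) (Fin m) ℝ} {S₂ : Fin K₂ → Matrix (Fin m) (Fin m) ℝ}
    (h₁ : ∀ l, (S₁ l).IsSymm) (h₂ : ∀ l, (S₂ l).IsSymm) :
    ∀ l, ((Fin.append S₁ S₂ : Fin (K₁ + K₂) → Matrix (Fin m) (Fin m) ℝ) l).IsSymm := by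
  intro l
  induction l using Fin.addCases with
  | left i => rw [Fin.append_left]; exact h₁ i
  | right j => rw [Fin.append_right]; exact h₂ j

/-- Splitting off the BOTTOM letter of a pencil: `∑ l, z^(e l) • T l = z^(e 0) • (T 0 + ∑ l, z^(e l.succ − e 0) • T l.succ)`
when `e 0 ≤ e l.succ` for all `l`. [folklore] -/
theorem pencil_eq_smul_bottom {m K : ℕ} (e : Fin (K + 1) → ℕ) (T : Fin (K + 1) → Matrix (Fin m) (Fin m) ℝ)
    (he : ∀ l : Fin K, e 0 ≤ e l.succ) (z : ℝ) :
    ∑ l, z ^ e l • T l = z ^ e 0 • (T 0 + ∑ l : Fin K, z ^ (e l.succ - e 0) • T l.succ) := by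
  rw [Fin.sum_univ_succ, smul_add, Finset.smul_sum]
  congr 1
  refine Finset.sum_congr rfl fun l _ => ?_
  rw [smul_smul, ← pow_add, Nat.add_sub_cancel' (he l)]

/-- Splitting off the TOP letter of a pencil at a nonzero point: `∑ l, y^(d l) • S l =
y^(d last) • (S last + ∑ i, (y^(d last − d i.castSucc))⁻¹ • S i.castSucc)` when `d i.castSucc ≤ d last` for all `i`. [folklore] -/
theorem pencil_eq_smul_top {m K : ℕ} (d : Fin (K + 1) → ℕ) (S : Fin (K + 1) → Matrix (Fin m) (Fin m) ℝ)
    (hd : ∀ i : Fin K, d i.castSucc ≤ d (Fin.last K)) {y : ℝ} (hy : y ≠ 0) :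
    ∑ l, y ^ d l • S l = y ^ d (Fin.last K) •
      (S (Fin.last K) + ∑ i : Fin K, (y ^ (d (Fin.last K) - d i.castSucc))⁻¹ • S i.castSucc) := by
  rw [Fin.sum_univ_castSucc, smul_add, Finset.smul_sum, add_comm]
  congr 1
  refine Finset.sum_congr rfl fun i _ => ?_
  rw [smul_smul]
  congr 1
  rw [eq_mul_inv_iff_mul_eq₀ (pow_ne_zero _ hy), ← pow_add, Nat.add_sub_cancel' (hd i)]

/-! ### The junction step -/

/-- **THE JUNCTION LAW (chain lemma, all formats).**  Two alternation certificates at the same size `m` — `P = ∑ X^(d l) • S l`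
(`K₁+1` letters, strictly increasing support, `N₁` alternations along `τ`) and `Q = ∑ X^(e l) • T l` (`K₂+1` letters, strictly
increasing support, `N₂` alternations along `σ`) — whose JUNCTION LETTERS AGREE (`T 0 = S last`: the bottom letter of `Q` is the
top letter of `P`) chain to ONE certificate with `K₁ + 1 + K₂` letters on a strictly increasing support and `N₁ + N₂` alternations:
the letters of `P` verbatim, then `Λ^{−(e l − e 0)} • T l` at exponent `d last + (e l − e 0)` (`l ≥ 1`) for a suitable scale `Λ > 0`.
In census words: `ζ_sym(m, K₁+K₂+1) ≥ ζ_alt(P) + ζ_alt(Q)` for matching junction letters. [folklore] -/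
theorem exists_alternating_junction {m K₁ K₂ N₁ N₂ : ℕ}
    (d : Fin (K₁ + 1) → ℕ) (S : Fin (K₁ + 1) → Matrix (Fin m) (Fin m) ℝ) (hd : StrictMono d)
    (hS : ∀ l, (S l).IsSymm) (τ : Fin (N₁ + 1) → ℝ) (hτ : StrictMono τ) (hτpos : ∀ j, 0 < τ j)
    (hne : ∀ j, (∑ l, τ j ^ d l • S l).det ≠ 0)
    (halt : ∀ j : Fin N₁, (∑ l, τ j.castSucc ^ d l • S l).det * (∑ l, τ j.succ ^ d l • S l).det < 0)
    (e : Fin (K₂ + 1) → ℕ) (T : Fin (K₂ + 1) → Matrix (Fin m) (Fin m) ℝ) (he : StrictMono e)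
    (hT : ∀ l, (T l).IsSymm) (σ : Fin (N₂ + 1) → ℝ) (hσ : StrictMono σ) (hσpos : ∀ j, 0 < σ j)
    (hne' : ∀ j, (∑ l, σ j ^ e l • T l).det ≠ 0)
    (halt' : ∀ j : Fin N₂, (∑ l, σ j.castSucc ^ e l • T l).det * (∑ l, σ j.succ ^ e l • T l).det < 0)
    (hJ : T 0 = S (Fin.last K₁)) :
    ∃ (d' : Fin (K₁ + 1 + K₂) → ℕ) (S' : Fin (K₁ + 1 + K₂) → Matrix (Fin m) (Fin m) ℝ)
      (τ' : Fin (N₁ + N₂ + 1) → ℝ),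
      StrictMono d' ∧ (∀ i : Fin (K₁ + 1), d' (Fin.castAdd K₂ i) = d i ∧ S' (Fin.castAdd K₂ i) = S i) ∧
      (∃ Λ : ℝ, 0 < Λ ∧ ∀ l : Fin K₂, d' (Fin.natAdd (K₁ + 1) l) = d (Fin.last K₁) + (e l.succ - e 0) ∧
        S' (Fin.natAdd (K₁ + 1) l) = (Λ ^ (e l.succ - e 0))⁻¹ • T l.succ) ∧
      (∀ l, (S' l).IsSymm) ∧ StrictMono τ' ∧ (∀ j, 0 < τ' j) ∧
      (∀ j, (∑ l, τ' j ^ d' l • S' l).det ≠ 0) ∧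
      ∀ j : Fin (N₁ + N₂), (∑ l, τ' j.castSucc ^ d' l • S' l).det * (∑ l, τ' j.succ ^ d' l • S' l).det < 0 := by
  classical
  -- exponent bookkeeping
  have hblt : ∀ l : Fin K₂, e 0 < e l.succ := fun l => he (Fin.succ_pos l)
  have hble : ∀ l : Fin K₂, e 0 ≤ e l.succ := fun l => (hblt l).le
  have hkpos : ∀ l : Fin K₂, e l.succ - e 0 ≠ 0 := fun l => by have := hblt l; omega
  have hdlt : ∀ i : Fin K₁, d i.castSucc < d (Fin.last K₁) := fun i => hd (Fin.castSucc_lt_last i)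
  have hdle : ∀ i : Fin K₁, d i.castSucc ≤ d (Fin.last K₁) := fun i => (hdlt i).le
  -- `Q` minus its bottom letter, shifted down: `R z = ∑_{l ≥ 1} z^(e l − e 0) • T l`
  set R : ℝ → Matrix (Fin m) (Fin m) ℝ := fun z => ∑ l : Fin K₂, z ^ (e l.succ - e 0) • T l.succ with hR
  have hQR : ∀ z : ℝ, ∑ l, z ^ e l • T l = z ^ e 0 • (S (Fin.last K₁) + R z) := fun z => by
    rw [pencil_eq_smul_bottom e T hble z, hJ]
  have hdetQ : ∀ z : ℝ, (∑ l, z ^ e l • T l).det = (z ^ e 0) ^ m * (S (Fin.last K₁) + R z).det := fun z => by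
    rw [hQR, det_smul, Fintype.card_fin]
  have hJRne : ∀ j, (S (Fin.last K₁) + R (σ j)).det ≠ 0 := fun j h0 => by
    apply hne' j
    rw [hdetQ, h0, mul_zero]
  -- (i) OLD points: the appended letters die as `Λ → ∞`
  have hold : ∀ j : Fin (N₁ + 1), ∀ᶠ Λ : ℝ in atTop,
      0 < ((∑ l, τ j ^ d l • S l) + ∑ l : Fin K₂, (τ j ^ (d (Fin.last K₁) + (e l.succ - e 0)) *
            (Λ ^ (e l.succ - e 0))⁻¹) • T l.succ).det * (∑ l, τ j ^ d l • S l).det := by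
    intro j
    have hc : ∀ l : Fin K₂, Tendsto (fun Λ : ℝ => τ j ^ (d (Fin.last K₁) + (e l.succ - e 0)) *
        (Λ ^ (e l.succ - e 0))⁻¹) atTop (𝓝 0) := by
      intro l
      have h := (tendsto_inv_atTop_zero.comp (tendsto_pow_atTop (hkpos l))).const_mul
        (τ j ^ (d (Fin.last K₁) + (e l.succ - e 0)))
      rw [mul_zero] at h
      exact h
    have hmat : Tendsto (fun Λ : ℝ => (∑ l, τ j ^ d l • S l) + ∑ l : Fin K₂,
        (τ j ^ (d (Fin.last K₁) + (e l.succ - e 0)) * (Λ ^ (e l.succ - e 0))⁻¹) • T l.succ) atTop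
        (𝓝 (∑ l, τ j ^ d l • S l)) := by
      have h := (tendsto_const_nhds (x := ∑ l, τ j ^ d l • S l) (f := (atTop : Filter ℝ))).add
        (tendsto_finsetSum Finset.univ fun l _ => (hc l).smul_const (T l.succ))
      simp only [zero_smul, Finset.sum_const_zero, add_zero] at h
      exact h
    have hdet := ((continuous_id.matrix_det).tendsto _).comp hmat
    exact eventually_mul_pos_of_tendsto hdet (hne j)
  -- (ii) NEW points `Λ σ j`: after dividing by `(Λ σ j)^a` the non-top letters of `P` die
  have hnew : ∀ j : Fin (N₂ + 1), ∀ᶠ Λ : ℝ in atTop,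
      0 < (S (Fin.last K₁) + ∑ i : Fin K₁, ((Λ * σ j) ^ (d (Fin.last K₁) - d i.castSucc))⁻¹ • S i.castSucc
            + R (σ j)).det * (S (Fin.last K₁) + R (σ j)).det := by
    intro j
    have hc : ∀ i : Fin K₁, Tendsto (fun Λ : ℝ => ((Λ * σ j) ^ (d (Fin.last K₁) - d i.castSucc))⁻¹)
        atTop (𝓝 0) := by
      intro i
      have hne0 : d (Fin.last K₁) - d i.castSucc ≠ 0 := by have := hdlt i; omega
      exact tendsto_inv_atTop_zero.comp
        ((tendsto_pow_atTop hne0).comp (tendsto_id.atTop_mul_const (hσpos j)))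
    have hmat : Tendsto (fun Λ : ℝ => S (Fin.last K₁) + ∑ i : Fin K₁,
        ((Λ * σ j) ^ (d (Fin.last K₁) - d i.castSucc))⁻¹ • S i.castSucc + R (σ j)) atTop
        (𝓝 (S (Fin.last K₁) + R (σ j))) := by
      have h := ((tendsto_const_nhds (x := S (Fin.last K₁)) (f := (atTop : Filter ℝ))).add
        (tendsto_finsetSum Finset.univ fun i _ => (hc i).smul_const (S i.castSucc))).add
        (tendsto_const_nhds (x := R (σ j)))
      simp only [zero_smul, Finset.sum_const_zero, add_zero] at h
      exact h
    have hdet := ((continuous_id.matrix_det).tendsto _).comp hmat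
    exact eventually_mul_pos_of_tendsto hdet (hJRne j)
  -- one scale `Λ` for all the finitely many eventual statements, positive and separating the two point sets
  have hΛpos : ∀ᶠ Λ : ℝ in atTop, 0 < Λ := eventually_gt_atTop 0
  have hsep : ∀ᶠ Λ : ℝ in atTop, τ (Fin.last N₁) < Λ * σ 0 :=
    (tendsto_id.atTop_mul_const (hσpos 0)).eventually_gt_atTop _
  obtain ⟨Λ, ⟨hDold, hDnew⟩, hΛ, hΛsep⟩ :=
    (((eventually_all.mpr hold).and (eventually_all.mpr hnew)).and (hΛpos.and hsep)).exists
  have hΛne : Λ ≠ 0 := hΛ.ne'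
  -- the chained pencil
  set d' : Fin (K₁ + 1 + K₂) → ℕ := Fin.append d (fun l : Fin K₂ => d (Fin.last K₁) + (e l.succ - e 0)) with hd'
  set S' : Fin (K₁ + 1 + K₂) → Matrix (Fin m) (Fin m) ℝ :=
    Fin.append S (fun l : Fin K₂ => (Λ ^ (e l.succ - e 0))⁻¹ • T l.succ) with hS'
  have heval : ∀ y : ℝ, ∑ l, y ^ d' l • S' l = (∑ l, y ^ d l • S l) + ∑ l : Fin K₂,
      (y ^ (d (Fin.last K₁) + (e l.succ - e 0)) * (Λ ^ (e l.succ - e 0))⁻¹) • T l.succ := by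
    intro y
    rw [hd', hS', append_eval]
    simp only [smul_smul]
  have hevalNew : ∀ z : ℝ, 0 < z →
      ∑ l, (Λ * z) ^ d' l • S' l = (Λ * z) ^ d (Fin.last K₁) •
        (S (Fin.last K₁) + ∑ i : Fin K₁, ((Λ * z) ^ (d (Fin.last K₁) - d i.castSucc))⁻¹ • S i.castSucc + R z) := by
    intro z hz
    have hyz : Λ * z ≠ 0 := mul_ne_zero hΛne hz.ne'
    rw [heval, pencil_eq_smul_top d S hdle hyz, hR]
    simp only [smul_add, Finset.smul_sum, smul_smul]
    congr 1
    refine Finset.sum_congr rfl fun l _ => ?_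
    congr 1
    rw [pow_add]
    field_simp
    ring
  -- signs carried at the old and at the new points
  have hdetOld : ∀ j : Fin (N₁ + 1),
      0 < (∑ l, τ j ^ d' l • S' l).det * (∑ l, τ j ^ d l • S l).det := fun j => by
    rw [heval]; exact hDold j
  have hdetNew : ∀ j : Fin (N₂ + 1),
      0 < (∑ l, (Λ * σ j) ^ d' l • S' l).det * (∑ l, σ j ^ e l • T l).det := by
    intro j
    rw [hevalNew (σ j) (hσpos j), det_smul, Fintype.card_fin, hdetQ]
    have h1 : 0 < ((Λ * σ j) ^ d (Fin.last K₁)) ^ m := pow_pos (pow_pos (mul_pos hΛ (hσpos j)) _) _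
    have h2 : 0 < (σ j ^ e 0) ^ m := pow_pos (pow_pos (hσpos j) _) _
    have h := mul_pos (mul_pos h1 h2) (hDnew j)
    have hrw : ((Λ * σ j) ^ d (Fin.last K₁)) ^ m *
          (S (Fin.last K₁) + ∑ i : Fin K₁, ((Λ * σ j) ^ (d (Fin.last K₁) - d i.castSucc))⁻¹ • S i.castSucc
            + R (σ j)).det *
        ((σ j ^ e 0) ^ m * (S (Fin.last K₁) + R (σ j)).det)
        = ((Λ * σ j) ^ d (Fin.last K₁)) ^ m * (σ j ^ e 0) ^ m *
          ((S (Fin.last K₁) + ∑ i : Fin K₁, ((Λ * σ j) ^ (d (Fin.last K₁) - d i.castSucc))⁻¹ • S i.castSucc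
            + R (σ j)).det * (S (Fin.last K₁) + R (σ j)).det) := by ring
    rw [hrw]
    exact h
  -- the junction sign rule: skip `σ 0` iff the signs at `τ last` and `σ 0` agree
  set ε : ℕ := if 0 < (∑ l, τ (Fin.last N₁) ^ d l • S l).det * (∑ l, σ 0 ^ e l • T l).det then 1 else 0 with hε
  have hε1 : ε ≤ 1 := by rw [hε]; split_ifs <;> norm_num
  -- the new test points and their sign carriers
  set τ' : Fin (N₁ + N₂ + 1) → ℝ := fun j =>
    if h : (j : ℕ) ≤ N₁ then τ ⟨j, Nat.lt_succ_of_le h⟩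
    else Λ * σ ⟨(j : ℕ) - (N₁ + 1) + ε, by omega⟩ with hτ'
  set s : Fin (N₁ + N₂ + 1) → ℝ := fun j =>
    if h : (j : ℕ) ≤ N₁ then (∑ l, τ ⟨j, Nat.lt_succ_of_le h⟩ ^ d l • S l).det
    else (∑ l, σ ⟨(j : ℕ) - (N₁ + 1) + ε, by omega⟩ ^ e l • T l).det with hs
  have hτ'_old : ∀ (j : Fin (N₁ + N₂ + 1)) (h : (j : ℕ) ≤ N₁), τ' j = τ ⟨j, Nat.lt_succ_of_le h⟩ :=
    fun j h => by simp only [hτ', dif_pos h]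
  have hτ'_new : ∀ (j : Fin (N₁ + N₂ + 1)) (h : ¬ (j : ℕ) ≤ N₁),
      τ' j = Λ * σ ⟨(j : ℕ) - (N₁ + 1) + ε, by omega⟩ :=
    fun j h => by simp only [hτ', dif_neg h]
  have hs_old : ∀ (j : Fin (N₁ + N₂ + 1)) (h : (j : ℕ) ≤ N₁),
      s j = (∑ l, τ ⟨j, Nat.lt_succ_of_le h⟩ ^ d l • S l).det :=
    fun j h => by simp only [hs, dif_pos h]
  have hs_new : ∀ (j : Fin (N₁ + N₂ + 1)) (h : ¬ (j : ℕ) ≤ N₁),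
      s j = (∑ l, σ ⟨(j : ℕ) - (N₁ + 1) + ε, by omega⟩ ^ e l • T l).det :=
    fun j h => by simp only [hs, dif_neg h]
  -- (F1) the carriers carry the signs
  have hF1 : ∀ j : Fin (N₁ + N₂ + 1), 0 < (∑ l, τ' j ^ d' l • S' l).det * s j := by
    intro j
    by_cases h : (j : ℕ) ≤ N₁
    · rw [hτ'_old j h, hs_old j h]
      exact hdetOld _
    · rw [hτ'_new j h, hs_new j h]
      exact hdetNew _
  -- (F2) consecutive carriers have opposite signs
  have hF2 : ∀ j : Fin (N₁ + N₂), s j.castSucc * s j.succ < 0 := by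
    intro j
    have hc : ((Fin.castSucc j : Fin (N₁ + N₂ + 1)) : ℕ) = j := rfl
    have hsu : ((Fin.succ j : Fin (N₁ + N₂ + 1)) : ℕ) = j + 1 := rfl
    by_cases h1 : (j : ℕ) + 1 ≤ N₁
    · rw [hs_old _ (by rw [hc]; omega), hs_old _ (by rw [hsu]; exact h1)]
      have := halt ⟨j, by omega⟩
      convert this using 3 <;> simp
    · by_cases h2 : (j : ℕ) ≤ N₁
      · -- the junction: `j = N₁`
        have hjN : (j : ℕ) = N₁ := by omega
        have hN₂ : 0 < N₂ := by have := j.isLt; omega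
        rw [hs_old _ (by rw [hc]; exact h2), hs_new _ (by rw [hsu]; omega)]
        have hlast : (⟨(Fin.castSucc j : ℕ), Nat.lt_succ_of_le (by rw [hc]; exact h2)⟩ : Fin (N₁ + 1))
            = Fin.last N₁ := Fin.ext (by simp [hjN])
        rw [hlast]
        have hx : (∑ l, τ (Fin.last N₁) ^ d l • S l).det ≠ 0 := hne _
        have hu : (∑ l, σ 0 ^ e l • T l).det ≠ 0 := hne' _
        by_cases hsgn : 0 < (∑ l, τ (Fin.last N₁) ^ d l • S l).det * (∑ l, σ 0 ^ e l • T l).det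
        · -- same sign: the first new point is `σ 1`
          have hε' : ε = 1 := by rw [hε, if_pos hsgn]
          have hidx : (⟨(Fin.succ j : ℕ) - (N₁ + 1) + ε, by omega⟩ : Fin (N₂ + 1))
              = Fin.succ ⟨0, hN₂⟩ := Fin.ext (by simp [hjN, hε'])
          rw [hidx]
          have h01 := halt' ⟨0, hN₂⟩
          have h0 : (Fin.castSucc (⟨0, hN₂⟩ : Fin N₂) : Fin (N₂ + 1)) = 0 := Fin.ext rfl
          rw [h0] at h01
          have hv : (∑ l, σ (Fin.succ ⟨0, hN₂⟩) ^ e l • T l).det ≠ 0 := hne' _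
          exact mul_neg_of_carriers hsgn (mul_self_pos.mpr hv) h01
        · -- opposite sign: the first new point is `σ 0`
          have hε' : ε = 0 := by rw [hε, if_neg hsgn]
          have hidx : (⟨(Fin.succ j : ℕ) - (N₁ + 1) + ε, by omega⟩ : Fin (N₂ + 1)) = 0 :=
            Fin.ext (by simp [hjN, hε'])
          rw [hidx]
          exact lt_of_le_of_ne (not_lt.mp hsgn) (mul_ne_zero hx hu)
      · -- two new points
        rw [hs_new _ (by rw [hc]; exact h2), hs_new _ (by rw [hsu]; omega)]
        have hi : (Fin.castSucc j : ℕ) - (N₁ + 1) + ε < N₂ := by rw [hc]; have := j.isLt; omega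
        have := halt' ⟨(Fin.castSucc j : ℕ) - (N₁ + 1) + ε, hi⟩
        have e1 : (Fin.castSucc (⟨(Fin.castSucc j : ℕ) - (N₁ + 1) + ε, hi⟩ : Fin N₂) : Fin (N₂ + 1))
            = ⟨(Fin.castSucc j : ℕ) - (N₁ + 1) + ε, by omega⟩ := Fin.ext rfl
        have e2 : (Fin.succ (⟨(Fin.castSucc j : ℕ) - (N₁ + 1) + ε, hi⟩ : Fin N₂) : Fin (N₂ + 1))
            = ⟨(Fin.succ j : ℕ) - (N₁ + 1) + ε, by omega⟩ := Fin.ext (by simp; omega)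
        rw [e1, e2] at this
        exact this
  -- assemble
  refine ⟨d', S', τ', ?_, fun i => ⟨?_, ?_⟩, ⟨Λ, hΛ, fun l => ⟨?_, ?_⟩⟩, ?_, ?_, ?_, fun j h0 => ?_,
    fun j => mul_neg_of_carriers (hF1 _) (hF1 _) (hF2 j)⟩
  · -- strictly increasing support
    rw [hd']
    refine strictMono_append hd ?_ ?_
    · intro l l' h
      have h' := he (Fin.succ_lt_succ_iff.mpr h)
      have := hble l
      show d (Fin.last K₁) + (e l.succ - e 0) < d (Fin.last K₁) + (e l'.succ - e 0)
      omega
    · intro l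
      have := hblt l
      show d (Fin.last K₁) < d (Fin.last K₁) + (e l.succ - e 0)
      omega
  · rw [hd', Fin.append_left]
  · rw [hS', Fin.append_left]
  · rw [hd', Fin.append_right]
  · rw [hS', Fin.append_right]
  · -- symmetric letters
    rw [hS']
    exact isSymm_append hS fun l => (hT l.succ).smul _
  · -- strictly increasing test points
    refine Fin.strictMono_iff_lt_succ.mpr fun j => ?_
    have hc : ((Fin.castSucc j : Fin (N₁ + N₂ + 1)) : ℕ) = j := rfl
    have hsu : ((Fin.succ j : Fin (N₁ + N₂ + 1)) : ℕ) = j + 1 := rfl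
    by_cases h1 : (j : ℕ) + 1 ≤ N₁
    · rw [hτ'_old _ (by rw [hc]; omega), hτ'_old _ (by rw [hsu]; exact h1)]
      exact hτ (Fin.mk_lt_mk.mpr (by rw [hc, hsu]; exact Nat.lt_succ_self _))
    · by_cases h2 : (j : ℕ) ≤ N₁
      · have hjN : (j : ℕ) = N₁ := by omega
        rw [hτ'_old _ (by rw [hc]; exact h2), hτ'_new _ (by rw [hsu]; omega)]
        have hlast : (⟨(Fin.castSucc j : ℕ), Nat.lt_succ_of_le (by rw [hc]; exact h2)⟩ : Fin (N₁ + 1))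
            = Fin.last N₁ := Fin.ext (by simp [hjN])
        rw [hlast]
        refine hΛsep.trans_le (mul_le_mul_of_nonneg_left (hσ.monotone ?_) hΛ.le)
        rw [Fin.le_def]
        simp
      · rw [hτ'_new _ (by rw [hc]; exact h2), hτ'_new _ (by rw [hsu]; omega)]
        refine mul_lt_mul_of_pos_left (hσ (Fin.mk_lt_mk.mpr ?_)) hΛ
        rw [hc, hsu]
        omega
  · -- positive test points
    intro j
    by_cases h : (j : ℕ) ≤ N₁
    · rw [hτ'_old j h]; exact hτpos _
    · rw [hτ'_new j h]; exact mul_pos hΛ (hσpos _)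
  · -- nonvanishing (from the carried sign)
    have h := hF1 j
    rw [h0, zero_mul] at h
    exact lt_irrefl 0 h

end Summit.ValiantsHypothesis.ValiantsHypothesis.Theorems.LacunarySymmetroidMatrixDescartes.Census.Chain
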